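import Summits.QuantumFields.YangMills.Theorems.ColdStartUniversalityLatticeLangevinEmpiricalAutocovariance
import HarnessLib

/-!
# Route `ColdStartUniversality` (fixed-cut-off SZZ dynamics, sampler package): ★★★ the EMPIRICAL AUTOCOVARIANCE of the sampled cold-start chain is a
# CONSISTENT estimator of the stationary autocovariance at every lag

Helper file (seat `ym-line-csu-p1`, g35; `--supports stmt-QuantumFields-24809`).  For every strong solution `U` of the SU(2) SZZ dynamics from a
deterministic start, every bounded measurable `|G| ≤ 1`, sampling step `h > 0` and lag `J`, as `N → ∞`

  `φ̂_N(J) := N⁻¹Σ_(k<N) G(U_kh)G(U_(k+J)h) − (N⁻¹Σ_(k<N) G(U_kh))²  →  ∫ G·κ_JhG dμ_(β') − (μ_(β')G)²`   IN PROBABILITY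

(★★★ `tendstoInMeasure_empiricalAutocovariance`; the limit is the stationary autocovariance `⟨Ĝ, κ_JhĜ⟩_μ` by the invariance of `μ_(β')` under the
transition kernels, file `…InvariantOfKernel`).  Via a generic Chebyshev step (`tendstoInMeasure_of_integral_sq_le`: a mean-square rate `D/N` gives
convergence in probability) from the rates of file `…EmpiricalAutocovariance` and of the mean-square ergodic theorem (file 55), and the algebra of
convergence in probability (file 105a).  This is the estimator practitioners use for autocorrelations and the integrated autocorrelation time.
THEOREMS ONLY, no definition, no sorry; [folklore].
HONEST FRAMING: fixed cut-off; constants depend on `L, β'`; `UniformColdStartMixing` (24809) is NOT restated; no crux, rung or summit statement is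
proved; the Yang–Mills mass gap is NOT proved.
-/

set_option autoImplicit false

noncomputable section

namespace Summit.QuantumFields.YangMills.Theorems.ColdStartUniversality

open MeasureTheory ProbabilityTheory Filter Topology Set
open scoped NNReal ENNReal BigOperators
open Literature Literature.Probability.Process Literature.MathematicalPhysics.QuantumFieldTheory
open Literature.MathematicalPhysics.QuantumLattice (fundamentalRep fundamentalLatticeRep continuous_fundamentalRep)

/-- ★ **Chebyshev step**: a mean-square rate `E[(X_N − c)²] ≤ D/N` (`N ≥ 1`) gives `X_N → c` in probability. [folklore] -/
theorem tendstoInMeasure_of_integral_sq_le {Ω : Type*} {mΩ : MeasurableSpace Ω} {P : Measure Ω} [IsProbabilityMeasure P] {X : ℕ → Ω → ℝ}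
    {c D : ℝ} (hint : ∀ N, Integrable (fun ω => (X N ω - c) ^ 2) P) (hle : ∀ N : ℕ, 1 ≤ N → ∫ ω, (X N ω - c) ^ 2 ∂P ≤ D / N) :
    TendstoInMeasure P X atTop fun _ => c := by
  rw [tendstoInMeasure_iff_measureReal_norm]
  intro ε hε
  have hDN : Tendsto (fun N : ℕ => D / N / ε ^ 2) atTop (𝓝 0) := by
    have h := (tendsto_const_nhds (x := D)).div_atTop tendsto_natCast_atTop_atTop
    simpa using h.div_const (ε ^ 2)
  refine tendsto_of_tendsto_of_tendsto_of_le_of_le' tendsto_const_nhds hDN (Eventually.of_forall fun N => measureReal_nonneg) ?_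
  filter_upwards [eventually_ge_atTop 1] with N hN
  have hset : {ω | ε ≤ ‖X N ω - c‖} ⊆ {ω | ε ^ 2 ≤ (X N ω - c) ^ 2} := fun ω hω => by
    simp only [Set.mem_setOf_eq, Real.norm_eq_abs] at hω ⊢
    calc ε ^ 2 ≤ |X N ω - c| ^ 2 := pow_le_pow_left₀ hε.le hω 2
      _ = (X N ω - c) ^ 2 := sq_abs _
  have hmarkov := mul_meas_ge_le_integral_of_nonneg (Eventually.of_forall fun ω => sq_nonneg (X N ω - c)) (hint N) (ε ^ 2)
  have hε2 : 0 < ε ^ 2 := by positivity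
  calc P.real {ω | ε ≤ ‖X N ω - c‖} ≤ P.real {ω | ε ^ 2 ≤ (X N ω - c) ^ 2} := measureReal_mono hset
    _ ≤ (∫ ω, (X N ω - c) ^ 2 ∂P) / ε ^ 2 := by rw [le_div_iff₀ hε2, mul_comm]; exact hmarkov
    _ ≤ D / N / ε ^ 2 := by gcongr; exact hle N hN

variable {L : ℕ} [NeZero L]

/-- ★★★ **Consistency of the empirical autocovariance** (see the module docstring): for every lag `J`, step `h > 0`, bounded measurable `|G| ≤ 1`
and every strong solution from a deterministic start, `N⁻¹Σ_(k<N) G(U_kh)G(U_(k+J)h) − (N⁻¹Σ_(k<N) G(U_kh))² → ∫ G·κ_JhG dμ_(β') − (μ_(β')G)²` in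
probability (fixed cut-off). [folklore] -/
theorem tendstoInMeasure_empiricalAutocovariance (L : ℕ) [NeZero L] (β' : ℝ)
    (κ : ℝ≥0 → Kernel (GaugeConfig 3 L (Matrix.specialUnitaryGroup (Fin 2) ℂ))
      (GaugeConfig 3 L (Matrix.specialUnitaryGroup (Fin 2) ℂ))) [∀ t, IsMarkovKernel (κ t)]
    (hreal : ∀ (t : ℝ≥0) (x : GaugeConfig 3 L (Matrix.specialUnitaryGroup (Fin 2) ℂ))
        (Ω : Type) [MeasurableSpace Ω] (P : Measure Ω) [IsProbabilityMeasure P]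
        (W : ℝ≥0 → Ω → (Edge 3 L × NoiseIdx 2 → ℝ)) (hW : IsFlatBrownian W P)
        (U : ℝ≥0 → Ω → GaugeConfig 3 L (Matrix.specialUnitaryGroup (Fin 2) ℂ)),
        (∀ ω, U 0 ω = x) →
        (latticeLangevinDynamics (fundamentalLatticeRep 2) β').IsSolution (fundamentalRep (Fin 2))
          hW.natFiltration P W U →
        κ t x = P.map (U t))
    (x : GaugeConfig 3 L (Matrix.specialUnitaryGroup (Fin 2) ℂ))
    {Ω : Type} [MeasurableSpace Ω] {P : Measure Ω} [IsProbabilityMeasure P]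
    {W : ℝ≥0 → Ω → (Edge 3 L × NoiseIdx 2 → ℝ)} (hW : IsFlatBrownian W P)
    {U : ℝ≥0 → Ω → GaugeConfig 3 L (Matrix.specialUnitaryGroup (Fin 2) ℂ)} (hU0 : ∀ ω, U 0 ω = x)
    (hU : (latticeLangevinDynamics (fundamentalLatticeRep 2) β').IsSolution (fundamentalRep (Fin 2)) hW.natFiltration P W U)
    {G : GaugeConfig 3 L (Matrix.specialUnitaryGroup (Fin 2) ℂ) → ℝ} (hG : Measurable G) (hG1 : ∀ z, |G z| ≤ 1)
    (h : ℝ≥0) (hh : 0 < h) (J : ℕ) :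
    TendstoInMeasure P (fun (N : ℕ) ω =>
        (N : ℝ)⁻¹ * (∑ k ∈ Finset.range N, G (U ((k : ℝ≥0) * h) ω) * G (U (((k + J : ℕ) : ℝ≥0) * h) ω)) -
          ((N : ℝ)⁻¹ * ∑ k ∈ Finset.range N, G (U ((k : ℝ≥0) * h) ω)) ^ 2) atTop
      (fun _ => (∫ y, G y * (∫ z, G z ∂(κ ((J : ℝ≥0) * h) y)) ∂(wilsonMeasure (d := 3) (L := L) (fundamentalRep (Fin 2)) β')) -
        (∫ z, G z ∂(wilsonMeasure (d := 3) (L := L) (fundamentalRep (Fin 2)) β')) ^ 2) := by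
  set μ : Measure (GaugeConfig 3 L (Matrix.specialUnitaryGroup (Fin 2) ℂ)) :=
    wilsonMeasure (d := 3) (L := L) (fundamentalRep (Fin 2)) β' with hμ
  haveI : IsProbabilityMeasure μ :=
    isProbabilityMeasure_wilsonMeasure (d := 3) (L := L) (fundamentalRep (Fin 2)) (continuous_fundamentalRep (Fin 2)) β'
  set ψ : ℝ := ∫ y, G y * (∫ z, G z ∂(κ ((J : ℝ≥0) * h) y)) ∂μ with hψ
  set m : ℝ := ∫ z, G z ∂μ with hm
  have hmU : ∀ u : ℝ≥0, Measurable (U u) := fun u => (hU.adapted u).mono (hW.natFiltration.le u) le_rfl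
  have hκm : Measurable fun y => ∫ z, G z ∂(κ ((J : ℝ≥0) * h) y) := (hG.stronglyMeasurable.integral_kernel (κ := κ ((J : ℝ≥0) * h))).measurable
  have hκb : ∀ y, |∫ z, G z ∂(κ ((J : ℝ≥0) * h) y)| ≤ 1 := fun y => by
    have hh' := norm_integral_le_of_norm_le_const (μ := κ ((J : ℝ≥0) * h) y) (f := G) (C := 1)
      (Eventually.of_forall fun z => by simpa [Real.norm_eq_abs] using hG1 z)
    simpa [Real.norm_eq_abs] using hh'
  have hψ1 : |ψ| ≤ 1 := by
    have hh' := norm_integral_le_of_norm_le_const (μ := μ) (f := fun y => G y * ∫ z, G z ∂(κ ((J : ℝ≥0) * h) y)) (C := 1)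
      (Eventually.of_forall fun y => by
        rw [Real.norm_eq_abs, abs_mul]
        calc |G y| * |∫ z, G z ∂(κ ((J : ℝ≥0) * h) y)| ≤ 1 * 1 := mul_le_mul (hG1 y) (hκb y) (abs_nonneg _) zero_le_one
          _ = 1 := one_mul _)
    simpa [Real.norm_eq_abs] using hh'
  have hm1 : |m| ≤ 1 := by
    have hh' := norm_integral_le_of_norm_le_const (μ := μ) (f := G) (C := 1) (Eventually.of_forall fun z => by simpa [Real.norm_eq_abs] using hG1 z)
    simpa [Real.norm_eq_abs] using hh'
  -- bounded averages are square integrable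
  have havg_bound : ∀ (F : ℕ → Ω → ℝ), (∀ k, Measurable (F k)) → (∀ k ω, |F k ω| ≤ 1) → ∀ (N : ℕ) (c : ℝ), |c| ≤ 1 →
      Integrable (fun ω => ((N : ℝ)⁻¹ * (∑ k ∈ Finset.range N, F k ω) - c) ^ 2) P := by
    intro F hFm hFb N c hc
    have hmeas : Measurable fun ω => ((N : ℝ)⁻¹ * (∑ k ∈ Finset.range N, F k ω) - c) ^ 2 :=
      (((Finset.measurable_sum _ fun k _ => hFm k).const_mul _).sub measurable_const).pow_const 2
    refine (integrable_const ((1 + 1) ^ 2 : ℝ)).mono' hmeas.aestronglyMeasurable (Eventually.of_forall fun ω => ?_)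
    rw [Real.norm_eq_abs, abs_pow]
    refine pow_le_pow_left₀ (abs_nonneg _) ((abs_sub _ _).trans (add_le_add ?_ hc)) 2
    rcases Nat.eq_zero_or_pos N with hN | hN
    · simp [hN]
    · have hN0 : (0 : ℝ) < N := by exact_mod_cast hN
      rw [abs_mul, abs_inv, abs_of_pos hN0]
      have hs : |∑ k ∈ Finset.range N, F k ω| ≤ N * 1 := (Finset.abs_sum_le_sum_abs _ _).trans (by
        calc ∑ k ∈ Finset.range N, |F k ω| ≤ ∑ _k ∈ Finset.range N, (1 : ℝ) := Finset.sum_le_sum fun k _ => hFb k ω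
          _ = N * 1 := by rw [Finset.sum_const, Finset.card_range, nsmul_eq_mul])
      calc (N : ℝ)⁻¹ * |_| ≤ (N : ℝ)⁻¹ * (N * 1) := mul_le_mul_of_nonneg_left hs (inv_nonneg.2 hN0.le)
        _ = 1 := by field_simp
  /- ### 1. The second moments at lag `J` -/
  obtain ⟨C, c, -, -, h109⟩ := integral_sq_empiricalSecondMoment_sub_le L β' κ hreal
  have hA : TendstoInMeasure P (fun (N : ℕ) ω => (N : ℝ)⁻¹ * ∑ k ∈ Finset.range N,
      G (U ((k : ℝ≥0) * h) ω) * G (U (((k + J : ℕ) : ℝ≥0) * h) ω)) atTop fun _ => ψ := by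
    refine tendstoInMeasure_of_integral_sq_le (D := 8 * (2 * J + 1) + 2 * (4 + 4 * C * Real.exp (-c * h) / (1 - Real.exp (-c * h))))
      (havg_bound (fun k ω => G (U ((k : ℝ≥0) * h) ω) * G (U (((k + J : ℕ) : ℝ≥0) * h) ω))
        (fun k => (hG.comp (hmU _)).mul (hG.comp (hmU _)))
        (fun k ω => by
          rw [abs_mul]
          calc |G (U ((k : ℝ≥0) * h) ω)| * |G (U (((k + J : ℕ) : ℝ≥0) * h) ω)| ≤ 1 * 1 :=
                mul_le_mul (hG1 _) (hG1 _) (abs_nonneg _) zero_le_one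
            _ = 1 := one_mul _) · ψ hψ1) fun N hN => ?_
    exact h109 x Ω P W hW U hU0 hU G hG hG1 h hh J N hN
  /- ### 2. The sample mean -/
  obtain ⟨C', c', -, -, h55⟩ := integral_sq_average_sub_wilson_le L β'
  have hM : TendstoInMeasure P (fun (N : ℕ) ω => (N : ℝ)⁻¹ * ∑ k ∈ Finset.range N, G (U ((k : ℝ≥0) * h) ω)) atTop fun _ => m := by
    refine tendstoInMeasure_of_integral_sq_le (D := 4 + 4 * C' * Real.exp (-c' * h) / (1 - Real.exp (-c' * h)))
      (havg_bound (fun k ω => G (U ((k : ℝ≥0) * h) ω)) (fun k => hG.comp (hmU _)) (fun k ω => hG1 _) · m hm1) fun N hN => ?_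
    exact h55 x Ω P W hW U hU0 hU G hG hG1 h hh N hN
  /- ### 3. Algebra of limits in probability -/
  have hsq := tendstoInMeasure_mul_of_const hM hM
  have hres := tendstoInMeasure_sub_of_const hA hsq
  simp only [← pow_two] at hres
  exact hres

end Summit.QuantumFields.YangMills.Theorems.ColdStartUniversality

end
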